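import Mathlib.Analysis.InnerProductSpace.PiL2
import Literature.MathematicalPhysics.StatisticalMechanics.Theil2006
import HarnessLib

/-!
# Contact numbers of congruent discs in the plane: Harborth 1974, Heitmann–Radin 1980

Topic `Literature/Geometry/DiscreteGeometry` (penny graphs / contact numbers). Two NAMED FACTS
(`def … : Prop`, never asserted; users take `(h : FactName)`), typed from the PRIMARY sources:

* H. Harborth, *Lösung zu Problem 664A* (problem posed by O. Reutter), Elem. Math. **29**
  (1974) 14–15 [Harborth1974], read on the e-periodica scan, pp. 14–15: "In einer Ebene sind `n`
  (`n ∈ ℕ`) kongruente abgeschlossene Kreisscheiben so gelagert, dass je zwei von ihnen höchstens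
  einen Punkt gemeinsam haben. […] Die Maximalzahl von Berührpunkten sei `B(n)`. Es sind
  `B(1) = 0` und `B(2) = 1` leicht einzusehen, und `B(0) = 0` sei zusätzlich definiert." Result,
  (5)–(6): "`B(n) ≤ [3n - √(12n-3)]` (5) […] `B(n) ≥ z ≥ [3n - √(12n-3)]` (6) […] Mit (5) und
  (6) erweist sich die Vermutung somit als richtig." (`[·]` = integer part) — `Harborth1974_contactNumber`.
* R. C. Heitmann, C. Radin, *The ground state for sticky disks*, J. Stat. Phys. **22** (1980)
  281–287 [HeitmannRadin1980], read on the authors' scan, p. 284: "**Theorem.** (1)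
  `B(n) = H(n) = [3n - (12n-3)^{1/2}]` (Harborth). (2) For any maximal configuration `C` of `n`
  disks, `n ≥ 3`: (a) `C_g` has a simple closed polygonal boundary with vertices on a triangular
  lattice and `C_v` consists of all the lattice points inside and on this polygon. (b) `C_g`
  contains exactly `-[3 - (12n-3)^{1/2}]` boundary vertices." Here (p. 283) `C` is a
  configuration of unit-diameter impenetrable disks, a bond is a touching pair, `C_b` the number
  of bonds, `C_v` the set of centres, `B(n) = sup C_b` over `n`-disk configurations, and `C` is
  *maximal* iff `C_b = B(n)`; the sticky energy (p. 281–282, `E = ½ ∑_{i ≠ j} V(|rᵢ - rⱼ|)` with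
  (1) `V = +∞ / -1 / 0` for `r < 1 / r = 1 / r > 1`) of a configuration is `-C_b`, so maximal
  configurations are exactly the ground states — `HeitmannRadin1980_groundStates` (part (2)(a)).

## Rendering

Configurations are labelled, `x : Fin N → EuclideanSpace ℝ (Fin 2)`, with the hard-disc
constraint `Pairwise fun i j => 1 ≤ dist (x i) (x j)` (unit DIAMETER; touching = distance exactly
`1`), exactly as in `Literature/MathematicalPhysics/StatisticalMechanics/Crystallization.lean`
(`interactionEnergy`, `stickyPotential`) and in the venture file
`Summits/Ventures/Crystal3D/StickySpheres/ContactGraph.lean` (`IsUnitPacking`, `numContacts`,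
`maxContacts`; that file cannot be imported here — Literature never imports Summits — so the
contact count is the definition `contactPairCount` below, written as the SAME expression, and the
venture's bridge `numContacts x = contactPairCount x` is `rfl`). Harborth's integer part
`[3n - √(12n-3)]` is `harborthNumber n = ⌊3n - √(12n-3)⌋ : ℤ` (`Real.sqrt`, so `n = 0` gives
`⌊0 - 0⌋ = 0 = B(0)` as Harborth stipulates; `n = 1, 2` give `0, 1`). The triangular lattice is the
tree's `Theil2006.triPoint : ℤ × ℤ →+ ℝ²` / `Theil2006.triangularLattice` (`A₂ = ℤ(1,0) + ℤ(½,√3/2)`),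
not re-declared. "Vertices on a triangular lattice" (HR (2)(a)) = on the image of `A₂` under a
rigid motion; we allow any linear isometry plus translation (`A₂` is invariant under the
reflections in question, so this is the same set of lattices).

## What is deliberately NOT here

* HR Theorem (2)(a) in full (simple closed lattice polygon as boundary, ALL lattice points inside
  and on it belong to `C_v`) and (2)(b) (the boundary-vertex count `⌈√(12n-3)⌉ - 3`) as NAMED
  FACTS in the labelled rendering: only the corollary "every centre is a lattice point" of (2)(a)
  is vendored here. Both are nevertheless THEOREMS of the tree, for centre sets `P : Finset ℂ`
  (the setting of the proof files): the polygon clause is `Harborth.HeitmannRadin_polygon`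
  (`HeitmannRadinPolygon.lean`: the boundary walk `Harborth.bdry` is a simple closed polygon with
  vertices on one triangular lattice, and `x ∈ P` iff `x` is a lattice point inside — in the
  bounded complementary component of, `IsJordanLoop.inside` — or on it), and (2)(b) is
  `Harborth.card_bdrySet_of_maximal` (`HeitmannRadinBoundaryCount.lean`).
* Proofs, in THIS file: the two results are stated here as named facts (`def … : Prop`) and
  DISCHARGED downstream — `Harborth1974_contactNumber_holds` (`HarborthContactNumberProof.lean`,
  with `HarborthConstruction.lean` for (6) and the Euler-free boundary-polygon induction
  `HarborthInduction.lean` … `ContactGraphBoundaryCycle.lean` for (5)) and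
  `HeitmannRadin1980_groundStates_holds` (`HeitmannRadinStructure.lean`, Heitmann–Radin's equality
  analysis of that induction, p. 286); users' hypotheses `(h : X)` are fed `X_holds`.
* Uniqueness of maximal configurations (false for most `n`), energy-per-particle limits, Wulff
  shapes (Au Yeung–Friesecke–Schmidt 2012, Schmidt 2013): other files.
-/

noncomputable section

namespace Literature.Geometry.DiscreteGeometry

open Finset
open Literature.MathematicalPhysics.StatisticalMechanics

/-! ## Contact pairs and Harborth's number -/

/-- The number of **contact pairs** (touching pairs, "bonds", Heitmann–Radin's `C_b`) of a
labelled configuration of unit-diameter balls: pairs of labels `i < j` at distance exactly `1`.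
Literally the expression defining the venture's `Summit.Ventures.Crystal3D.numContacts`.
[cite: HeitmannRadin1980, §2 (p. 283)] -/
def contactPairCount {d N : ℕ} (x : Fin N → EuclideanSpace ℝ (Fin d)) : ℕ :=
  (univ.filter fun p : Fin N × Fin N => p.1 < p.2 ∧ dist (x p.1) (x p.2) = 1).card

/-- **Harborth's number** `[3n - √(12n - 3)]` (integer part), the maximal number of contact
points of `n` congruent non-overlapping discs (Reutter's conjecture, Harborth's theorem). As an
integer floor of a real number; `n = 0, 1, 2, 3, …, 7` give `0, 0, 1, 3, 5, 7, 9, 12`.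
[cite: Harborth1974, (5)–(6)] -/
def harborthNumber (n : ℕ) : ℤ :=
  ⌊(3 * n : ℝ) - Real.sqrt (12 * n - 3)⌋

/-- A configuration of `N` unit discs in the plane is **maximal** (Heitmann–Radin, p. 283:
"`C` … will be called 'maximal' if `C_b = B(n)`") when it is a hard configuration (distinct
centres at distance `≥ 1`) whose number of contact pairs is not exceeded by any hard
configuration of `N` discs; equivalently, a ground state of the sticky-disc energy.
[cite: HeitmannRadin1980, §2 (p. 283)] -/
def IsMaximalDiscConfig {N : ℕ} (x : Fin N → EuclideanSpace ℝ (Fin 2)) : Prop :=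
  (Pairwise fun i j => 1 ≤ dist (x i) (x j)) ∧
    ∀ y : Fin N → EuclideanSpace ℝ (Fin 2), (Pairwise fun i j => 1 ≤ dist (y i) (y j)) →
      contactPairCount y ≤ contactPairCount x

/-! ## The named facts -/

/-- NAMED FACT — **Harborth 1974 (Reutter's Problem 664A): the maximal number of contact points
of `n` congruent non-overlapping discs in the plane is `[3n - √(12n - 3)]`.** As printed (Elem.
Math. 29, pp. 14–15): "`B(n) ≤ [3n - √(12n-3)]` (5)" for every configuration, and the hexagonal
'Kranz' configurations give "`B(n) ≥ z ≥ [3n - √(12n-3)]` (6)"; `B(0) = 0`, `B(1) = 0`,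
`B(2) = 1`. Rendered for labelled configurations of unit-DIAMETER discs (contact = distance `1`):
for every `N`, every hard configuration has at most `harborthNumber N` contact pairs, and some
hard configuration has exactly that many. (= Heitmann–Radin 1980, Theorem (1).) Users take
`(h : Harborth1974_contactNumber)`. [cite: Harborth1974, (5)–(6)] -/
def Harborth1974_contactNumber : Prop :=
  ∀ N : ℕ,
    (∀ x : Fin N → EuclideanSpace ℝ (Fin 2), (Pairwise fun i j => 1 ≤ dist (x i) (x j)) →
        (contactPairCount x : ℤ) ≤ harborthNumber N) ∧
      ∃ x : Fin N → EuclideanSpace ℝ (Fin 2), (Pairwise fun i j => 1 ≤ dist (x i) (x j)) ∧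
        (contactPairCount x : ℤ) = harborthNumber N

/-- NAMED FACT — **Heitmann–Radin 1980, Theorem (2)(a) (corollary form): every ground state of
`n ≥ 3` sticky discs is a subset of a triangular lattice.** As printed (J. Stat. Phys. 22, p. 284):
"For any maximal configuration `C` of `n` disks, `n ≥ 3`: (a) `C_g` has a simple closed polygonal
boundary with vertices on a triangular lattice and `C_v` consists of all the lattice points inside
and on this polygon." Vendored consequence: all centres of a maximal configuration lie on ONE
congruent copy `A(A₂) + t` of the triangular lattice `A₂ = Theil2006.triangularLattice` (`A` a
linear isometry of `ℝ²`, `t` a translation). The polygon structure and part (2)(b) are not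
vendored (module docstring). Users take `(h : HeitmannRadin1980_groundStates)`.
[cite: HeitmannRadin1980, Theorem (2)(a), p. 284] -/
def HeitmannRadin1980_groundStates : Prop :=
  ∀ N : ℕ, 3 ≤ N → ∀ x : Fin N → EuclideanSpace ℝ (Fin 2), IsMaximalDiscConfig x →
    ∃ (A : EuclideanSpace ℝ (Fin 2) →ₗᵢ[ℝ] EuclideanSpace ℝ (Fin 2)) (t : EuclideanSpace ℝ (Fin 2)),
      ∀ i : Fin N, ∃ k : ℤ × ℤ, x i = A (Theil2006.triPoint k) + t

/-! ## API -/

/-- Under Harborth's theorem every hard configuration of `N` unit discs has at most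
`⌊3N - √(12N - 3)⌋` contact pairs. [cite: Harborth1974, (5)] -/
theorem Harborth1974_contactNumber.contactPairCount_le (h : Harborth1974_contactNumber) {N : ℕ}
    {x : Fin N → EuclideanSpace ℝ (Fin 2)} (hx : Pairwise fun i j => 1 ≤ dist (x i) (x j)) :
    (contactPairCount x : ℤ) ≤ harborthNumber N :=
  (h N).1 x hx

/-- Under Harborth's theorem the bound is attained: a maximal configuration of `N` unit discs
has exactly `⌊3N - √(12N - 3)⌋` contact pairs. [cite: Harborth1974, (5)–(6)] -/
theorem Harborth1974_contactNumber.contactPairCount_eq_of_isMaximal (h : Harborth1974_contactNumber)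
    {N : ℕ} {x : Fin N → EuclideanSpace ℝ (Fin 2)} (hx : IsMaximalDiscConfig x) :
    (contactPairCount x : ℤ) = harborthNumber N := by
  obtain ⟨y, hy, hyN⟩ := (h N).2
  refine le_antisymm ((h N).1 x hx.1) ?_
  rw [← hyN]
  exact_mod_cast hx.2 y hy

/-- `12n - 3` is a perfect square exactly at the centred hexagonal numbers `n = 3s² + 3s + 1`,
where `√(12n - 3) = 6s + 3` and Harborth's number is `9s² + 3s` (the complete hexagon `H_s`,
Heitmann–Radin (2)). [cite: HeitmannRadin1980, §3 (2)] -/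
theorem harborthNumber_hexagonal (s : ℕ) :
    harborthNumber (3 * s ^ 2 + 3 * s + 1) = 9 * s ^ 2 + 3 * s := by
  have hs : (0 : ℝ) ≤ 6 * s + 3 := by positivity
  have hsq : (12 * ((3 * s ^ 2 + 3 * s + 1 : ℕ) : ℝ) - 3) = (6 * s + 3) ^ 2 := by
    push_cast; ring
  rw [harborthNumber, hsq, Real.sqrt_sq hs]
  have : (3 * ((3 * s ^ 2 + 3 * s + 1 : ℕ) : ℝ) - (6 * s + 3)) = ((9 * s ^ 2 + 3 * s : ℤ) : ℝ) := by
    push_cast; ring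
  rw [this, Int.floor_intCast]

/-- Sanity values: `harborthNumber 7 = 12` (the hexagon `H₁`: centre plus six). [cite: HeitmannRadin1980, §3 (2)] -/
theorem harborthNumber_seven : harborthNumber 7 = 12 := by
  simpa using harborthNumber_hexagonal 1

end Literature.Geometry.DiscreteGeometry

end
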